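import Literature.Analysis.Convexity.AnisotropicIsoperimetricMollifier
import Literature.Analysis.Convexity.AnisotropicIsoperimetricBrunnMinkowski
import Mathlib.Analysis.Calculus.MeanValue
import Mathlib.MeasureTheory.Measure.Lebesgue.EqHaar
import HarnessLib

/-!
# The anisotropic isoperimetric inequality, III: first-order expansion of the sup-convolution
# of a mollified indicator

Topic `Literature/Analysis/Convexity`; third file of the series `AnisotropicIsoperimetric*.lean`.
Gardner's derivation of the isoperimetric inequality from Brunn–Minkowski (Bull. AMS 2002, §5,
(13)–(14)) differentiates the volume of the outer parallel body `vol(A + εK)` at `ε = 0`. For a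
general measurable set this derivative (the outer Minkowski content) may exceed the perimeter, so
the series runs the argument for the MOLLIFIED indicator `u = ρ * χ_G` (`ρ ∈ C²_c` a probability
kernel): this file supplies the upper bound of the sup-convolution
`U(x) = sup_{z ∈ K'} u(x − z)` by its first-order expansion,

  `∫ U ≤ ∫ u + ∫ sup_{z ∈ K'} (−Du(x)[z]) dx + L · r² · vol(G) · vol(B(0, R_ρ + r))`

for every nonempty compact `K' ⊆ B̄(0, r)` containing `0` (`lintegral_supConv_le`), where `L` is
a Lipschitz constant of `Dρ` and `supp ρ ⊆ B̄(0, R_ρ)`. Ingredients: the mean value inequality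
(`Convex.norm_image_sub_le_of_norm_fderiv_le'`) with the local Lipschitz estimate
`‖Du(y) − Du(x)‖ ≤ L ‖y − x‖ · vol(G ∩ B̄(x, R_ρ + ‖y − x‖))` (`norm_fderiv_sub_le`), and Tonelli
for `∫ vol(G ∩ B̄(x, s)) dx = vol(G) · vol(B̄(0, s))`.

All statements on `EuclideanSpace ℝ (Fin n)` with Lebesgue measure, Lebesgue integrals in
`ℝ≥0∞`; no definition is introduced.

## References
* R. J. Gardner, *The Brunn–Minkowski inequality*, Bull. AMS 39 (2002), §5, (13)–(14).
  [`Gardner2002`]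
* L. C. Evans, R. F. Gariepy, *Measure Theory and Fine Properties of Functions*, revised ed.
  (CRC 2015), §5.2.2 Thm 5.3. [`EvansGariepy2015`]
-/

noncomputable section

open Set Filter Function Metric
open _root_.MeasureTheory _root_.MeasureTheory.Measure ContinuousLinearMap
open scoped ENNReal NNReal Topology Convolution InnerProductSpace Pointwise

namespace Literature.Analysis.Convexity

variable {n : ℕ}

/-! ### A local Lipschitz estimate for the derivative of a mollified indicator -/

/-- Directional form: for `u = ρ * χ_G` with `Dρ` `L`-Lipschitz and `supp ρ ⊆ B̄(0, R)`,
`|Du(y)[w] − Du(x)[w]| ≤ L ‖y − x‖ ‖w‖ · vol(G ∩ B̄(x, R + ‖y − x‖))` (the kernels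
`∂_w ρ(y − ·) − ∂_w ρ(x − ·)` differ by at most `L‖y − x‖‖w‖` and only on that ball).
[cite: EvansGariepy2015, §5.2.2 Thm 5.3 (proof, step 1)] -/
theorem abs_fderiv_apply_sub_le {ρ : EuclideanSpace ℝ (Fin n) → ℝ} (hρ : ContDiff ℝ 1 ρ)
    (hcρ : HasCompactSupport ρ) {L : ℝ≥0} (hL : LipschitzWith L (fderiv ℝ ρ)) {R : ℝ}
    (hR : tsupport ρ ⊆ closedBall 0 R) {G : Set (EuclideanSpace ℝ (Fin n))}
    (hG : MeasurableSet G) (hGfin : volume G < ⊤) (x y w : EuclideanSpace ℝ (Fin n)) :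
    |fderiv ℝ (ρ ⋆[lsmul ℝ ℝ, volume] (G.indicator fun _ => (1 : ℝ))) y w -
        fderiv ℝ (ρ ⋆[lsmul ℝ ℝ, volume] (G.indicator fun _ => (1 : ℝ))) x w| ≤
      L * ‖y - x‖ * ‖w‖ * (volume (G ∩ closedBall x (R + ‖y - x‖))).toReal := by
  set χ : EuclideanSpace ℝ (Fin n) → ℝ := G.indicator fun _ => (1 : ℝ) with hχ_def
  have hχi : Integrable χ volume :=
    (integrable_indicator_iff hG).2 (integrableOn_const hGfin.ne)
  set ψ : EuclideanSpace ℝ (Fin n) → ℝ := fun t => fderiv ℝ ρ t w with hψ_def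
  have hψc : Continuous ψ := (hρ.continuous_fderiv one_ne_zero).clm_apply continuous_const
  have hψs : HasCompactSupport ψ := hcρ.fderiv_apply (𝕜 := ℝ) w
  have hψi : Integrable ψ volume := hψc.integrable_of_hasCompactSupport hψs
  -- the support of `ψ` lies in the ball of radius `R`
  have hψR : ∀ t, ψ t ≠ 0 → t ∈ closedBall (0 : EuclideanSpace ℝ (Fin n)) R := by
    intro t ht
    have : fderiv ℝ ρ t ≠ 0 := fun h => ht (by simp [hψ_def, h])
    exact hR (support_fderiv_subset ℝ this)
  rw [fderiv_convolution_apply_eq hρ hcρ hχi.locallyIntegrable,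
    fderiv_convolution_apply_eq hρ hcρ hχi.locallyIntegrable]
  simp only [convolution_eq_swap, lsmul_apply, smul_eq_mul]
  -- both integrands are integrable
  have hint : ∀ v : EuclideanSpace ℝ (Fin n), Integrable (fun t => ψ (v - t) * χ t) volume := by
    intro v
    have h1 : Integrable (fun t => ψ (v - t)) volume :=
      hψi.comp_sub_left v
    refine h1.bdd_mul (c := 1) hχi.aestronglyMeasurable (Eventually.of_forall fun t => ?_)
      |>.congr ?_
    · rw [hχ_def]; by_cases ht : t ∈ G <;> simp [ht]
    · exact Eventually.of_forall fun t => by ring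
  rw [← integral_sub (hint y) (hint x)]
  -- pointwise bound by a constant on `G ∩ B̄(x, R + ‖y - x‖)`, zero elsewhere
  set S := G ∩ closedBall x (R + ‖y - x‖) with hS
  have hSm : MeasurableSet S := hG.inter isClosed_closedBall.measurableSet
  have hSfin : volume S < ⊤ := lt_of_le_of_lt (measure_mono inter_subset_left) hGfin
  have hpt : ∀ t, ‖ψ (y - t) * χ t - ψ (x - t) * χ t‖ ≤
      S.indicator (fun _ => (L : ℝ) * ‖y - x‖ * ‖w‖) t := by
    intro t
    by_cases htG : t ∈ G
    · have hχt : χ t = 1 := by simp [hχ_def, htG]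
      rw [hχt, mul_one, mul_one]
      by_cases htB : t ∈ closedBall x (R + ‖y - x‖)
      · rw [Set.indicator_of_mem (Set.mem_inter htG htB)]
        have h1 : ‖fderiv ℝ ρ (y - t) - fderiv ℝ ρ (x - t)‖ ≤ L * ‖y - x‖ := by
          have := hL.dist_le_mul (y - t) (x - t)
          rwa [dist_eq_norm, dist_eq_norm, show y - t - (x - t) = y - x by abel] at this
        calc ‖ψ (y - t) - ψ (x - t)‖ = ‖(fderiv ℝ ρ (y - t) - fderiv ℝ ρ (x - t)) w‖ := by
              simp [hψ_def]
          _ ≤ ‖fderiv ℝ ρ (y - t) - fderiv ℝ ρ (x - t)‖ * ‖w‖ := le_opNorm _ _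
          _ ≤ L * ‖y - x‖ * ‖w‖ := by gcongr
      · -- outside the ball both kernels vanish
        have hy0 : ψ (y - t) = 0 := by
          by_contra h
          have := hψR _ h
          rw [mem_closedBall, dist_zero_right] at this
          apply htB
          rw [mem_closedBall, dist_comm, dist_eq_norm]
          calc ‖x - t‖ = ‖(y - t) - (y - x)‖ := by abel_nf
            _ ≤ ‖y - t‖ + ‖y - x‖ := norm_sub_le _ _
            _ ≤ R + ‖y - x‖ := by gcongr
        have hx0 : ψ (x - t) = 0 := by
          by_contra h
          have := hψR _ h
          rw [mem_closedBall, dist_zero_right] at this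
          apply htB
          rw [mem_closedBall, dist_comm, dist_eq_norm]
          linarith [norm_nonneg (y - x)]
        rw [hy0, hx0, sub_self, norm_zero]
        exact Set.indicator_nonneg (fun _ _ => by positivity) _
    · have hχt : χ t = 0 := by simp [hχ_def, htG]
      rw [hχt, mul_zero, mul_zero, sub_self, norm_zero]
      exact Set.indicator_nonneg (fun _ _ => by positivity) _
  calc |∫ t, ψ (y - t) * χ t - ψ (x - t) * χ t|
      = ‖∫ t, ψ (y - t) * χ t - ψ (x - t) * χ t‖ := (Real.norm_eq_abs _).symm
    _ ≤ ∫ t, S.indicator (fun _ => (L : ℝ) * ‖y - x‖ * ‖w‖) t :=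
        norm_integral_le_of_norm_le ((integrable_indicator_iff hSm).2
          (integrableOn_const hSfin.ne)) (Eventually.of_forall hpt)
    _ = L * ‖y - x‖ * ‖w‖ * (volume S).toReal := by
        rw [integral_indicator hSm, setIntegral_const, smul_eq_mul, mul_comm]
        rfl

/-- Operator-norm form of the local Lipschitz estimate:
`‖Du(y) − Du(x)‖ ≤ L ‖y − x‖ · vol(G ∩ B̄(x, R + ‖y − x‖))` for `u = ρ * χ_G`.
[cite: EvansGariepy2015, §5.2.2 Thm 5.3 (proof, step 1)] -/
theorem norm_fderiv_sub_le {ρ : EuclideanSpace ℝ (Fin n) → ℝ} (hρ : ContDiff ℝ 1 ρ)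
    (hcρ : HasCompactSupport ρ) {L : ℝ≥0} (hL : LipschitzWith L (fderiv ℝ ρ)) {R : ℝ}
    (hR : tsupport ρ ⊆ closedBall 0 R) {G : Set (EuclideanSpace ℝ (Fin n))}
    (hG : MeasurableSet G) (hGfin : volume G < ⊤) (x y : EuclideanSpace ℝ (Fin n)) :
    ‖fderiv ℝ (ρ ⋆[lsmul ℝ ℝ, volume] (G.indicator fun _ => (1 : ℝ))) y -
        fderiv ℝ (ρ ⋆[lsmul ℝ ℝ, volume] (G.indicator fun _ => (1 : ℝ))) x‖ ≤
      L * ‖y - x‖ * (volume (G ∩ closedBall x (R + ‖y - x‖))).toReal := by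
  refine ContinuousLinearMap.opNorm_le_bound _ (by positivity) fun w => ?_
  rw [sub_apply, Real.norm_eq_abs]
  calc _ ≤ L * ‖y - x‖ * ‖w‖ * (volume (G ∩ closedBall x (R + ‖y - x‖))).toReal :=
        abs_fderiv_apply_sub_le hρ hcρ hL hR hG hGfin x y w
    _ = L * ‖y - x‖ * (volume (G ∩ closedBall x (R + ‖y - x‖))).toReal * ‖w‖ := by ring


/-! ### Tonelli: sliding a ball over a set of finite volume -/

/-- Measurability of `x ↦ vol(G ∩ B̄(x, s))` (a section measure of the measurable set
`{(x, t) : t ∈ G, dist t x ≤ s}`). [folklore] -/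
private theorem measurable_measure_inter_closedBall {G : Set (EuclideanSpace ℝ (Fin n))}
    (hG : MeasurableSet G) (s : ℝ) :
    Measurable fun x : EuclideanSpace ℝ (Fin n) => volume (G ∩ closedBall x s) := by
  have hS : MeasurableSet {p : EuclideanSpace ℝ (Fin n) × EuclideanSpace ℝ (Fin n) |
      p.2 ∈ G ∧ dist p.2 p.1 ≤ s} :=
    (hG.preimage measurable_snd).inter
      (measurableSet_le (measurable_snd.dist measurable_fst) measurable_const)
  have h := measurable_measure_prodMk_left (ν := (volume : Measure (EuclideanSpace ℝ (Fin n)))) hS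
  have hEq : (fun x : EuclideanSpace ℝ (Fin n) => volume (G ∩ closedBall x s)) = fun x =>
      volume (Prod.mk x ⁻¹' {p : EuclideanSpace ℝ (Fin n) × EuclideanSpace ℝ (Fin n) |
        p.2 ∈ G ∧ dist p.2 p.1 ≤ s}) := by
    funext x
    congr 1
  rw [hEq]
  exact h

/-- `∫ vol(G ∩ B̄(x, s)) dx = vol(G) · vol(B̄(0, s))` (Tonelli and translation invariance).
[folklore] -/
private theorem lintegral_volume_inter_closedBall {G : Set (EuclideanSpace ℝ (Fin n))}
    (hG : MeasurableSet G) (s : ℝ) :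
    ∫⁻ x, volume (G ∩ closedBall x s) =
      volume G * volume (closedBall (0 : EuclideanSpace ℝ (Fin n)) s) := by
  set f : EuclideanSpace ℝ (Fin n) → EuclideanSpace ℝ (Fin n) → ℝ≥0∞ := fun x t =>
    G.indicator 1 t * (closedBall (0 : EuclideanSpace ℝ (Fin n)) s).indicator 1 (x - t)
    with hf
  have hball : ∀ x t : EuclideanSpace ℝ (Fin n),
      (closedBall (0 : EuclideanSpace ℝ (Fin n)) s).indicator (1 : EuclideanSpace ℝ (Fin n) → ℝ≥0∞)
          (x - t) = (closedBall x s).indicator 1 t := by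
    intro x t
    have : x - t ∈ closedBall (0 : EuclideanSpace ℝ (Fin n)) s ↔ t ∈ closedBall x s := by
      rw [mem_closedBall, mem_closedBall, dist_zero_right, dist_eq_norm, ← norm_neg, neg_sub]
    by_cases h : t ∈ closedBall x s
    · rw [Set.indicator_of_mem h, Set.indicator_of_mem (this.2 h), Pi.one_apply, Pi.one_apply]
    · rw [Set.indicator_of_notMem h, Set.indicator_of_notMem (fun h' => h (this.1 h'))]
  have hfx : ∀ x, ∫⁻ t, f x t = volume (G ∩ closedBall x s) := by
    intro x
    rw [← lintegral_indicator_one (hG.inter isClosed_closedBall.measurableSet)]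
    refine lintegral_congr fun t => ?_
    rw [hf]
    dsimp only
    rw [hball, ← Set.indicator_indicator]
    by_cases h1 : t ∈ G
    · rw [Set.indicator_of_mem h1, Set.indicator_of_mem h1, Pi.one_apply, one_mul]
    · rw [Set.indicator_of_notMem h1, Set.indicator_of_notMem h1, zero_mul]
  have hmeas : Measurable (uncurry f) := by
    refine Measurable.mul ?_ ?_
    · exact (measurable_one.indicator hG).comp measurable_snd
    · exact (measurable_one.indicator isClosed_closedBall.measurableSet).comp
        (measurable_fst.sub measurable_snd)
  calc ∫⁻ x, volume (G ∩ closedBall x s) = ∫⁻ x, ∫⁻ t, f x t := lintegral_congr fun x => (hfx x).symm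
    _ = ∫⁻ t, ∫⁻ x, f x t := lintegral_lintegral_swap hmeas.aemeasurable
    _ = ∫⁻ t, G.indicator 1 t * volume (closedBall (0 : EuclideanSpace ℝ (Fin n)) s) := by
        refine lintegral_congr fun t => ?_
        rw [hf]
        dsimp only
        have hne : G.indicator (1 : EuclideanSpace ℝ (Fin n) → ℝ≥0∞) t ≠ ⊤ :=
          ((Set.indicator_le_self _ _ t).trans_lt (by simp)).ne
        rw [lintegral_const_mul' _ _ hne, lintegral_sub_right_eq_self
          (fun x => (closedBall (0 : EuclideanSpace ℝ (Fin n)) s).indicator 1 x) t,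
          lintegral_indicator_one isClosed_closedBall.measurableSet]
    _ = volume G * volume (closedBall (0 : EuclideanSpace ℝ (Fin n)) s) := by
        rw [lintegral_mul_const _ (measurable_one.indicator hG), lintegral_indicator_one hG]

/-! ### The first-order expansion of the sup-convolution -/

/-- **Pointwise first-order bound.** For `u = ρ * χ_G` (`ρ ∈ C¹_c`, `Dρ` `L`-Lipschitz,
`supp ρ ⊆ B̄(0, R)`) and a nonempty compact `K' ⊆ B̄(0, r)`:
`sup_{z ∈ K'} u(x − z) ≤ u(x) + sup_{z ∈ K'} (−Du(x)[z]) + L r² · vol(G ∩ B̄(x, R + r))`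
(mean value inequality with the local Lipschitz estimate `norm_fderiv_sub_le`).
[cite: Gardner2002, §5 (13)–(14)] -/
theorem sSup_image_sub_le {ρ : EuclideanSpace ℝ (Fin n) → ℝ} (hρ : ContDiff ℝ 1 ρ)
    (hcρ : HasCompactSupport ρ) {L : ℝ≥0} (hL : LipschitzWith L (fderiv ℝ ρ)) {R : ℝ}
    (hR : tsupport ρ ⊆ closedBall 0 R) {G : Set (EuclideanSpace ℝ (Fin n))}
    (hG : MeasurableSet G) (hGfin : volume G < ⊤) {K' : Set (EuclideanSpace ℝ (Fin n))}
    (hKc : IsCompact K') (hKne : K'.Nonempty) {r : ℝ} (hr : 0 ≤ r)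
    (hKr : K' ⊆ closedBall 0 r) (x : EuclideanSpace ℝ (Fin n)) :
    sSup ((fun z => (ρ ⋆[lsmul ℝ ℝ, volume] (G.indicator fun _ => (1 : ℝ))) (x - z)) '' K') ≤
      (ρ ⋆[lsmul ℝ ℝ, volume] (G.indicator fun _ => (1 : ℝ))) x +
        sSup ((fun z => -(fderiv ℝ (ρ ⋆[lsmul ℝ ℝ, volume] (G.indicator fun _ => (1 : ℝ))) x z))
          '' K') +
        L * r ^ 2 * (volume (G ∩ closedBall x (R + r))).toReal := by
  set u := ρ ⋆[lsmul ℝ ℝ, volume] (G.indicator fun _ => (1 : ℝ)) with hu_def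
  have hχi : Integrable (G.indicator fun _ => (1 : ℝ)) volume :=
    (integrable_indicator_iff hG).2 (integrableOn_const hGfin.ne)
  have hu : ContDiff ℝ 1 u := hcρ.contDiff_convolution_left _ hρ hχi.locallyIntegrable
  have hud : ∀ y, DifferentiableAt ℝ u y := fun y => (hu.differentiable one_ne_zero) y
  set m : ℝ := (volume (G ∩ closedBall x (R + r))).toReal with hm
  have hm0 : 0 ≤ m := ENNReal.toReal_nonneg
  -- the derivative stays within `L r m` of `Du x` on the ball `B̄(x, r)`
  have hbound : ∀ y ∈ closedBall x r, ‖fderiv ℝ u y - fderiv ℝ u x‖ ≤ L * r * m := by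
    intro y hy
    rw [mem_closedBall, dist_eq_norm] at hy
    refine (norm_fderiv_sub_le hρ hcρ hL hR hG hGfin x y).trans ?_
    have hfin : volume (G ∩ closedBall x (R + r)) ≠ ⊤ :=
      (lt_of_le_of_lt (measure_mono inter_subset_left) hGfin).ne
    have hmono : (volume (G ∩ closedBall x (R + ‖y - x‖))).toReal ≤ m :=
      ENNReal.toReal_mono hfin (measure_mono (inter_subset_inter_right _
        (closedBall_subset_closedBall (by linarith))))
    have hfinal : (L : ℝ) * ‖y - x‖ * (volume (G ∩ closedBall x (R + ‖y - x‖))).toReal ≤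
        L * r * m := by gcongr
    exact hfinal
  -- the sup of `-Du x` over `K'` is attained-bounded
  have hcD : Continuous fun z => -(fderiv ℝ u x z) := (fderiv ℝ u x).continuous.neg
  have hbdd : BddAbove ((fun z => -(fderiv ℝ u x z)) '' K') := (hKc.image hcD).bddAbove
  refine csSup_le (hKne.image _) ?_
  rintro _ ⟨z, hz, rfl⟩
  have hzr : ‖z‖ ≤ r := by simpa using hKr hz
  have hxz : x - z ∈ closedBall x r := by
    rw [mem_closedBall, dist_eq_norm, sub_sub_cancel_left, norm_neg]; exact hzr
  have hMVT := (convex_closedBall x r).norm_image_sub_le_of_norm_fderiv_le' (fun y _ => hud y)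
    hbound (mem_closedBall_self hr) hxz
  rw [Real.norm_eq_abs, show x - z - x = -z by abel] at hMVT
  have h1 : u (x - z) - u x - fderiv ℝ u x (-z) ≤ L * r * m * ‖-z‖ := (le_abs_self _).trans hMVT
  rw [norm_neg] at h1
  have h2 : (L : ℝ) * r * m * ‖z‖ ≤ L * r ^ 2 * m := by
    calc (L : ℝ) * r * m * ‖z‖ ≤ L * r * m * r := by gcongr
      _ = L * r ^ 2 * m := by ring
  have h3 : fderiv ℝ u x (-z) ≤ sSup ((fun z => -(fderiv ℝ u x z)) '' K') := by
    rw [map_neg]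
    exact le_csSup hbdd (mem_image_of_mem _ hz)
  linarith

/-- **First-order expansion of the sup-convolution, integrated.** With `u = ρ * χ_G` as above
(`vol G < ∞`) and a nonempty compact `K' ⊆ B̄(0, r)`,
`∫ sup_{z ∈ K'} u(· − z) ≤ ∫ u + ∫ sup_{z ∈ K'} (−Du(·)[z]) + L r² · vol(G) · vol(B̄(0, R + r))`
(Lebesgue integrals of the positive parts; Tonelli for the remainder term). This is the upper
bound matching the Brunn–Minkowski lower bound of part I at first order in `r`.
[cite: Gardner2002, §5 (13)–(14)] -/
theorem lintegral_supConv_le {ρ : EuclideanSpace ℝ (Fin n) → ℝ} (hρ : ContDiff ℝ 1 ρ)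
    (hcρ : HasCompactSupport ρ) {L : ℝ≥0} (hL : LipschitzWith L (fderiv ℝ ρ)) {R : ℝ}
    (hR : tsupport ρ ⊆ closedBall 0 R) {G : Set (EuclideanSpace ℝ (Fin n))}
    (hG : MeasurableSet G) (hGfin : volume G < ⊤) {K' : Set (EuclideanSpace ℝ (Fin n))}
    (hKc : IsCompact K') (hKne : K'.Nonempty) {r : ℝ} (hr : 0 ≤ r)
    (hKr : K' ⊆ closedBall 0 r) :
    ∫⁻ x, ENNReal.ofReal (sSup ((fun z =>
        (ρ ⋆[lsmul ℝ ℝ, volume] (G.indicator fun _ => (1 : ℝ))) (x - z)) '' K')) ≤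
      (∫⁻ x, ENNReal.ofReal ((ρ ⋆[lsmul ℝ ℝ, volume] (G.indicator fun _ => (1 : ℝ))) x)) +
      (∫⁻ x, ENNReal.ofReal (sSup ((fun z =>
        -(fderiv ℝ (ρ ⋆[lsmul ℝ ℝ, volume] (G.indicator fun _ => (1 : ℝ))) x z)) '' K'))) +
      ENNReal.ofReal (L * r ^ 2) * volume G *
        volume (closedBall (0 : EuclideanSpace ℝ (Fin n)) (R + r)) := by
  set u := ρ ⋆[lsmul ℝ ℝ, volume] (G.indicator fun _ => (1 : ℝ)) with hu_def
  have hpt := fun x => sSup_image_sub_le hρ hcρ hL hR hG hGfin hKc hKne hr hKr x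
  have hfin : ∀ x, volume (G ∩ closedBall x (R + r)) ≠ ⊤ := fun x =>
    (lt_of_le_of_lt (measure_mono inter_subset_left) hGfin).ne
  calc ∫⁻ x, ENNReal.ofReal (sSup ((fun z => u (x - z)) '' K'))
      ≤ ∫⁻ x, (ENNReal.ofReal (u x) +
          ENNReal.ofReal (sSup ((fun z => -(fderiv ℝ u x z)) '' K')) +
          ENNReal.ofReal (L * r ^ 2) * volume (G ∩ closedBall x (R + r))) := by
        refine lintegral_mono fun x => ?_
        refine (ENNReal.ofReal_le_ofReal (hpt x)).trans ?_
        refine (ENNReal.ofReal_add_le).trans (add_le_add ENNReal.ofReal_add_le ?_)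
        rw [ENNReal.ofReal_mul (by positivity), ENNReal.ofReal_toReal (hfin x)]
    _ = (∫⁻ x, ENNReal.ofReal (u x)) +
          (∫⁻ x, ENNReal.ofReal (sSup ((fun z => -(fderiv ℝ u x z)) '' K'))) +
          ENNReal.ofReal (L * r ^ 2) * ∫⁻ x, volume (G ∩ closedBall x (R + r)) := by
        rw [lintegral_add_right' _ ?_, lintegral_add_left' ?_, lintegral_const_mul' _ _
          ENNReal.ofReal_ne_top]
        · -- measurability of `ofReal ∘ u`
          have hχi : Integrable (G.indicator fun _ => (1 : ℝ)) volume :=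
            (integrable_indicator_iff hG).2 (integrableOn_const hGfin.ne)
          exact ((hcρ.contDiff_convolution_left _ hρ
            hχi.locallyIntegrable).continuous.measurable.ennreal_ofReal).aemeasurable
        · exact ((measurable_measure_inter_closedBall hG (R + r)).const_mul _).aemeasurable
    _ = _ := by rw [lintegral_volume_inter_closedBall hG]; ring
end Literature.Analysis.Convexity

end
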